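import Mathlib
import HarnessLib
import Literature.NumberTheory.LFunctions.SawtoothPartialSums

/-!
# Truncated Poisson summation in Euler–Maclaurin form (Titchmarsh §4.7, Lemmas 4.7 and 4.10)

Topic `Literature/NumberTheory/LFunctions`. Third file of a proof of the Hardy–Littlewood
approximate functional equation (Titchmarsh, *The Theory of the Riemann Zeta-Function*, 2nd ed.,
Theorem 4.13). Titchmarsh's Lemma 4.7 (van der Corput): for `f` real with `f'` continuous and
steadily decreasing on `(a, b)`, `f'(b) = α`, `f'(a) = β`,
`∑_{a < n ≤ b} e^{2πi f(n)} = ∑_{α-η < ν < β+η} ∫_a^b e^{2πi(f(x) - νx)} dx + O(log(β - α + 2))`,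
and Lemma 4.10 is the same with a positive decreasing weight `g(n)`. The printed proof starts
from the Euler–Maclaurin formula (2.1.2),
`∑_{a<n≤b} φ(n) = ∫_a^b φ + ∫_a^b (x - [x] - 1/2) φ'(x) dx + (boundary terms)`, expands the
sawtooth into its Fourier series and integrates term by term, and then estimates the terms with
`ν` outside `(α - η, β + η)` by the second mean-value theorem.

This file proves the part of that argument which does not depend on the phase: the *exact finite
expansion* obtained by replacing the sawtooth `ψ` by its `V`-th partial sum `ψ_V`
(`Literature/NumberTheory/LFunctions/SawtoothPartialSums.lean`), with an explicit remainder that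
is small for `V` large. For `φ : ℝ → ℂ` continuously differentiable on `[a, b]`, `0 ≤ a ≤ b`:

* `Literature.NumberTheory.LFunctions.AFE.sum_Ioc_eq_eulerMaclaurin` — (2.1.2):
  `∑_{a<n≤b} φ(n) = ∫_a^b φ + ∫_a^b ψ φ' + ψ(a)φ(a) - ψ(b)φ(b)`;
* `Literature.NumberTheory.LFunctions.AFE.integral_sawPartial_mul_eq` —
  `∫_a^b ψ_V φ' = -∑_{ν=1}^V (1/(2πiν)) (∫_a^b φ'(x) e(νx) dx - ∫_a^b φ'(x) e(-νx) dx)`,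
  `e(y) = exp(2πiy)`;
* `Literature.NumberTheory.LFunctions.AFE.norm_sum_Ioc_sub_expansion_le` — the truncated expansion
  `∑_{a<n≤b} φ(n) = ∫_a^b φ + ψ(a)φ(a) - ψ(b)φ(b)`
  `  - ∑_{ν=1}^V (1/(2πiν)) (∫_a^b φ' e(νx) - ∫_a^b φ' e(-νx)) + R_V`,
  `‖R_V‖ ≤ Φ (b - a + 2) η_V` whenever `‖φ'‖ ≤ Φ` on `[a, b]`, `η_V = (3 + log(2V+1))/(2V+1)`;
* `Literature.NumberTheory.LFunctions.AFE.sawEta_le_of_le`, `Literature.NumberTheory.LFunctions.AFE.exists_sawEta_le` — `η_V ≤ δ` for `V ≥ 25/δ²` (so the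
  remainder can be made arbitrarily small by taking `V` large, uniformly from some `V₀` on).

(Integrating `∫ φ' e(νx)` by parts turns the `ν`-th term into `∫_a^b φ(x) e(νx) dx` plus
boundary terms, which is the form (4.7.1); the sequel keeps the `φ'` form for the terms far from
the stationary range, exactly as in Titchmarsh's proof, because it is absolutely summable in `ν`.)

## References

* E. C. Titchmarsh, *The Theory of the Riemann Zeta-Function*, 2nd ed. (rev. D. R. Heath-Brown),
  Oxford 1986, §2.1 eq. (2.1.2), §4.7 (Lemma 4.7 and its proof), §4.10 (Lemma 4.10).
-/

noncomputable section

open Real Complex MeasureTheory Set intervalIntegral Finset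

namespace Literature.NumberTheory.LFunctions.AFE

/-! ## Euler–Maclaurin summation of order one, (2.1.2) -/

/-- `[t] = t - ψ(t) - 1/2`. [folklore] -/
theorem natFloor_eq_sub_saw {t : ℝ} (ht : 0 ≤ t) : ((⌊t⌋₊ : ℕ) : ℝ) = t - saw t - 1 / 2 := by
  rw [saw_def, ← Int.self_sub_floor, natCast_floor_eq_intCast_floor ht]; ring

/-- `[t] = t - ψ(t) - 1/2`, cast to `ℂ`. [folklore] -/
theorem natFloor_eq_sub_saw' {t : ℝ} (ht : 0 ≤ t) :
    ((⌊t⌋₊ : ℕ) : ℂ) = (t : ℂ) - saw t - 1 / 2 := by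
  have h := congrArg (fun r : ℝ => (r : ℂ)) (natFloor_eq_sub_saw ht)
  push_cast at h
  exact h

/-- **Euler–Maclaurin summation, Titchmarsh (2.1.2)**: for `0 ≤ a ≤ b` and `φ` continuously
differentiable on `[a, b]`,
`∑_{a < n ≤ b} φ(n) = ∫_a^b φ(x) dx + ∫_a^b (x - [x] - 1/2) φ'(x) dx + ψ(a)φ(a) - ψ(b)φ(b)`
(`ψ(x) = x - [x] - 1/2`; derived here from Abel summation). [cite: Titchmarsh1986, eq. (2.1.2)] -/
theorem sum_Ioc_eq_eulerMaclaurin {a b : ℝ} (ha : 0 ≤ a) (hab : a ≤ b) {φ φ' : ℝ → ℂ}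
    (hφ : ∀ t ∈ Icc a b, HasDerivAt φ (φ' t) t) (hφ'c : ContinuousOn φ' (Icc a b)) :
    ∑ n ∈ Finset.Ioc ⌊a⌋₊ ⌊b⌋₊, φ n
      = (∫ x in a..b, φ x) + (∫ x in a..b, (saw x : ℂ) * φ' x)
        + (saw a : ℂ) * φ a - (saw b : ℂ) * φ b := by
  have hb : 0 ≤ b := ha.trans hab
  -- Abel summation with `c ≡ 1`
  have hdiff : ∀ t ∈ Icc a b, DifferentiableAt ℝ φ t := fun t ht => (hφ t ht).differentiableAt
  have hderiv : EqOn (deriv φ) φ' (Icc a b) := fun t ht => (hφ t ht).deriv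
  have hφ'i : IntegrableOn φ' (Icc a b) := hφ'c.integrableOn_Icc
  have hdi : IntegrableOn (deriv φ) (Icc a b) := hφ'i.congr_fun hderiv.symm measurableSet_Icc
  have habel := sum_mul_eq_sub_sub_integral_mul (fun _ => (1 : ℂ)) ha hab hdiff hdi
  simp only [mul_one, Finset.sum_const, Nat.card_Icc, tsub_zero, nsmul_eq_mul] at habel
  rw [habel]
  -- rewrite the set integral as an interval integral of `φ' t * (t - saw t + 1/2)`
  have hI : ∫ t in Ioc a b, deriv φ t * ((⌊t⌋₊ + 1 : ℕ) : ℂ)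
      = ∫ t in a..b, φ' t * ((t : ℂ) - saw t + 1 / 2) := by
    rw [intervalIntegral.integral_of_le hab]
    apply setIntegral_congr_fun measurableSet_Ioc
    intro t ht
    have ht0 : 0 ≤ t := ha.trans ht.1.le
    simp only [hderiv ⟨ht.1.le, ht.2⟩]
    congr 1
    push_cast
    rw [natFloor_eq_sub_saw' ht0]; ring
  rw [hI]
  -- the pieces
  have hφc : ContinuousOn φ (Icc a b) :=
    fun t ht => (hφ t ht).continuousAt.continuousWithinAt
  have huIcc : uIcc a b = Icc a b := uIcc_of_le hab
  have hφ'int : IntervalIntegrable φ' volume a b := by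
    rw [intervalIntegrable_iff_integrableOn_Icc_of_le hab]; exact hφ'i
  have hsaw_int : IntervalIntegrable (fun t => (saw t : ℂ) * φ' t) volume a b := by
    rw [intervalIntegrable_iff_integrableOn_Ioc_of_le hab] at hφ'int ⊢
    refine hφ'int.bdd_mul (c := 1 / 2) ?_ ?_
    · exact (Complex.continuous_ofReal.measurable.comp
        (Literature.NumberTheory.LFunctions.measurable_bernoulliPer 1)).aestronglyMeasurable
    · exact Filter.Eventually.of_forall fun t => by
        rw [Complex.norm_real, Real.norm_eq_abs]; exact abs_saw_le t
  have hid_int : IntervalIntegrable (fun t => φ' t * (t : ℂ)) volume a b :=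
    hφ'int.mul_continuousOn (Complex.continuous_ofReal.continuousOn)
  have hFTC : ∫ t in a..b, φ' t = φ b - φ a :=
    intervalIntegral.integral_eq_sub_of_hasDerivAt (by rw [huIcc]; exact hφ) hφ'int
  have hparts : ∫ t in a..b, (t : ℂ) * φ' t = b * φ b - a * φ a - ∫ t in a..b, φ t := by
    have h := intervalIntegral.integral_mul_deriv_eq_deriv_mul (u := fun t : ℝ => (t : ℂ))
      (u' := fun _ => (1 : ℂ)) (v := φ) (v' := φ') (a := a) (b := b)
      (fun t _ => by simpa using (hasDerivAt_id t).ofReal_comp)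
      (by rw [huIcc]; exact hφ) intervalIntegrable_const hφ'int
    rw [h]; simp
  -- expand `∫ φ' (t - ψ + 1/2)`
  have hexp : ∫ t in a..b, φ' t * ((t : ℂ) - saw t + 1 / 2)
      = (∫ t in a..b, (t : ℂ) * φ' t) - (∫ t in a..b, (saw t : ℂ) * φ' t)
        + (1 / 2) * ∫ t in a..b, φ' t := by
    have e : (fun t : ℝ => φ' t * ((t : ℂ) - saw t + 1 / 2))
        = fun t : ℝ => ((t : ℂ) * φ' t - (saw t : ℂ) * φ' t) + (1 / 2 : ℂ) * φ' t := by
      funext t; ring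
    rw [e, intervalIntegral.integral_add (hid_int.congr (fun t _ => by ring) |>.sub hsaw_int)
      (hφ'int.const_mul _), intervalIntegral.integral_sub (hid_int.congr (fun t _ => by ring))
      hsaw_int, intervalIntegral.integral_const_mul]
  rw [hexp, hparts, hFTC]
  push_cast
  rw [natFloor_eq_sub_saw' ha, natFloor_eq_sub_saw' hb]
  ring


/-! ## The sawtooth replaced by its partial sum -/

/-- **Term-by-term integration of the partial sum** (the finite part of Titchmarsh's "multiply
by an integrable function and integrate term-by-term", §4.7): for `g` integrable on `[a, b]`,
`∫_a^b ψ_V(x) g(x) dx = -∑_{ν=1}^V (1/(2πiν)) (∫_a^b g(x) e(νx) dx - ∫_a^b g(x) e(-νx) dx)`,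
`e(y) = exp(2πiy)`. [cite: Titchmarsh1986, §4.7] -/
theorem integral_sawPartial_mul_eq {a b : ℝ} (V : ℕ) {g : ℝ → ℂ}
    (hg : IntervalIntegrable g volume a b) :
    ∫ x in a..b, (sawPartial V x : ℂ) * g x
      = -∑ ν ∈ Finset.Icc 1 V, (1 / (2 * π * I * ν)) *
          ((∫ x in a..b, g x * Complex.exp (2 * π * I * ν * x))
            - ∫ x in a..b, g x * Complex.exp (-(2 * π * I * ν * x))) := by
  have e : ∀ x : ℝ, (sawPartial V x : ℂ) * g x
      = -∑ ν ∈ Finset.Icc 1 V, (1 / (2 * π * I * ν)) *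
          (g x * Complex.exp (2 * π * I * ν * x) - g x * Complex.exp (-(2 * π * I * ν * x))) := by
    intro x
    rw [sawPartial_eq_sum_cexp, neg_mul, Finset.sum_mul]
    congr 1
    apply Finset.sum_congr rfl
    intro ν _
    ring
  simp_rw [e]
  have hterm : ∀ ν ∈ Finset.Icc 1 V, IntervalIntegrable (fun x : ℝ => (1 / (2 * π * I * ν)) *
      (g x * Complex.exp (2 * π * I * ν * x) - g x * Complex.exp (-(2 * π * I * ν * x))))
      volume a b := by
    intro ν _
    apply IntervalIntegrable.const_mul
    exact (hg.mul_continuousOn (by fun_prop)).sub (hg.mul_continuousOn (by fun_prop))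
  rw [intervalIntegral.integral_neg, intervalIntegral.integral_finsetSum hterm]
  congr 1
  apply Finset.sum_congr rfl
  intro ν _
  rw [intervalIntegral.integral_const_mul,
    intervalIntegral.integral_sub (hg.mul_continuousOn (by fun_prop))
      (hg.mul_continuousOn (by fun_prop))]

/-- **Truncated Poisson summation with explicit remainder** (the finite skeleton of Titchmarsh's
Lemmas 4.7/4.10): for `0 ≤ a ≤ b`, `V ≥ 1`, `φ` continuously differentiable on `[a, b]` with
`‖φ'‖ ≤ Φ` there,
`∑_{a<n≤b} φ(n) = ∫_a^b φ + ψ(a)φ(a) - ψ(b)φ(b)`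
`  - ∑_{ν=1}^V (1/(2πiν)) (∫_a^b φ'(x) e(νx) dx - ∫_a^b φ'(x) e(-νx) dx) + R_V`,
`‖R_V‖ ≤ Φ (b - a + 2) η_V`, `η_V = (3 + log(2V+1))/(2V+1)` (`R_V = ∫_a^b (ψ - ψ_V) φ'`).
[cite: Titchmarsh1986, Lemma 4.7 (proof) and Lemma 4.10] -/
theorem norm_sum_Ioc_sub_expansion_le {a b : ℝ} (ha : 0 ≤ a) (hab : a ≤ b) {V : ℕ} (hV : 1 ≤ V)
    {φ φ' : ℝ → ℂ} (hφ : ∀ t ∈ Icc a b, HasDerivAt φ (φ' t) t)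
    (hφ'c : ContinuousOn φ' (Icc a b)) {Φ : ℝ} (hΦ : ∀ t ∈ Icc a b, ‖φ' t‖ ≤ Φ) :
    ‖(∑ n ∈ Finset.Ioc ⌊a⌋₊ ⌊b⌋₊, φ n)
        - ((∫ x in a..b, φ x) + (saw a : ℂ) * φ a - (saw b : ℂ) * φ b
          - ∑ ν ∈ Finset.Icc 1 V, (1 / (2 * π * I * ν)) *
            ((∫ x in a..b, φ' x * Complex.exp (2 * π * I * ν * x))
              - ∫ x in a..b, φ' x * Complex.exp (-(2 * π * I * ν * x))))‖
      ≤ Φ * (b - a + 2) * sawEta V := by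
  have huIcc : uIcc a b = Icc a b := uIcc_of_le hab
  have hφ'int : IntervalIntegrable φ' volume a b := by
    rw [intervalIntegrable_iff_integrableOn_Icc_of_le hab]; exact hφ'c.integrableOn_Icc
  have hΦ0 : 0 ≤ Φ := (norm_nonneg _).trans (hΦ a (left_mem_Icc.2 hab))
  -- integrability of `ψ φ'` and `ψ_V φ'`
  have hmeas_saw : Measurable saw := Literature.NumberTheory.LFunctions.measurable_bernoulliPer 1
  have hsaw_int : IntervalIntegrable (fun t => (saw t : ℂ) * φ' t) volume a b := by
    rw [intervalIntegrable_iff_integrableOn_Ioc_of_le hab] at hφ'int ⊢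
    refine hφ'int.bdd_mul (c := 1 / 2) ?_ ?_
    · exact (Complex.continuous_ofReal.measurable.comp hmeas_saw).aestronglyMeasurable
    · exact Filter.Eventually.of_forall fun t => by
        rw [Complex.norm_real, Real.norm_eq_abs]; exact abs_saw_le t
  have hsawP_int : IntervalIntegrable (fun t => (sawPartial V t : ℂ) * φ' t) volume a b := by
    apply hφ'int.continuousOn_mul
    apply Continuous.continuousOn
    apply Complex.continuous_ofReal.comp
    unfold sawPartial; fun_prop
  -- the identity `LHS = ∫ (ψ - ψ_V) φ'`
  have hsP := integral_sawPartial_mul_eq V hφ'int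
  rw [sum_Ioc_eq_eulerMaclaurin ha hab hφ hφ'c]
  have hdiff : (∫ x in a..b, (saw x : ℂ) * φ' x) - ∫ x in a..b, (sawPartial V x : ℂ) * φ' x
      = ∫ x in a..b, ((saw x - sawPartial V x : ℝ) : ℂ) * φ' x := by
    rw [← intervalIntegral.integral_sub hsaw_int hsawP_int]
    congr 1; funext x; push_cast; ring
  have e : (∫ x in a..b, φ x) + (∫ x in a..b, (saw x : ℂ) * φ' x) + (saw a : ℂ) * φ a
        - (saw b : ℂ) * φ b
      - ((∫ x in a..b, φ x) + (saw a : ℂ) * φ a - (saw b : ℂ) * φ b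
          - ∑ ν ∈ Finset.Icc 1 V, (1 / (2 * π * I * ν)) *
            ((∫ x in a..b, φ' x * Complex.exp (2 * π * I * ν * x))
              - ∫ x in a..b, φ' x * Complex.exp (-(2 * π * I * ν * x))))
      = (∫ x in a..b, (saw x : ℂ) * φ' x) - ∫ x in a..b, (sawPartial V x : ℂ) * φ' x := by
    rw [hsP]; ring
  rw [e, hdiff]
  -- estimate
  calc ‖∫ x in a..b, ((saw x - sawPartial V x : ℝ) : ℂ) * φ' x‖
      ≤ ∫ x in a..b, Φ * |saw x - sawPartial V x| := by
        apply intervalIntegral.norm_integral_le_of_norm_le hab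
        · exact Filter.Eventually.of_forall fun t ht => by
            rw [norm_mul, Complex.norm_real, Real.norm_eq_abs, mul_comm]
            exact mul_le_mul_of_nonneg_right (hΦ t ⟨ht.1.le, ht.2⟩) (abs_nonneg _)
        · exact (intervalIntegrable_abs_saw_sub_sawPartial V a b).const_mul Φ
    _ = Φ * ∫ x in a..b, |saw x - sawPartial V x| := intervalIntegral.integral_const_mul _ _
    _ ≤ Φ * ((b - a + 2) * sawEta V) :=
        mul_le_mul_of_nonneg_left (integral_abs_saw_sub_sawPartial_le hV hab) hΦ0
    _ = Φ * (b - a + 2) * sawEta V := by ring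


/-- **The remainder can be made small**: `η_V → 0`; explicitly `η_V ≤ δ` as soon as
`V ≥ 25/δ²`, using `log x ≤ 2√x`, `η_V ≤ 5/√(2V+1)`. [folklore] -/
theorem sawEta_le_of_le {δ : ℝ} (hδ : 0 < δ) {V : ℕ} (hV : 25 / δ ^ 2 ≤ V) :
    sawEta V ≤ δ := by
  set W : ℕ := V with hW
  have hK1 : (1 : ℝ) ≤ 2 * W + 1 := by
    have : (0 : ℝ) ≤ W := Nat.cast_nonneg W
    linarith
  have hKpos : (0 : ℝ) < 2 * W + 1 := by linarith
  set r : ℝ := Real.sqrt (2 * W + 1) with hr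
  have hrpos : 0 < r := Real.sqrt_pos.2 hKpos
  have hr2 : r ^ 2 = 2 * W + 1 := Real.sq_sqrt hKpos.le
  have hr1 : 1 ≤ r := by rw [hr]; exact Real.one_le_sqrt.2 hK1
  -- `log(2W+1) ≤ 2 √(2W+1)`
  have hlog : Real.log (2 * W + 1) ≤ 2 * r := by
    have h := Real.log_le_rpow_div hKpos.le (by norm_num : (0 : ℝ) < 1 / 2)
    rw [← Real.sqrt_eq_rpow] at h
    linarith [h, show Real.sqrt (2 * W + 1) / (1 / 2) = 2 * r by rw [hr]; ring]
  -- `η_W ≤ 5/r`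
  have h1 : sawEta W ≤ 5 / r := by
    rw [sawEta, div_le_div_iff₀ hKpos hrpos]
    have h := mul_le_mul_of_nonneg_right (add_le_add_left hlog 3) hrpos.le
    nlinarith [hr2, hr1]
  -- `5/r ≤ δ` since `r² = 2W+1 ≥ 25/δ²`
  have h2 : 5 / r ≤ δ := by
    rw [div_le_iff₀ hrpos]
    have h25 : 25 / δ ^ 2 ≤ r ^ 2 := by rw [hr2]; linarith
    have h3 : (5 / δ) ^ 2 ≤ r ^ 2 := by rw [div_pow]; norm_num; exact h25
    have h4 : 5 / δ ≤ r := (pow_le_pow_iff_left₀ (by positivity) hrpos.le two_ne_zero).1 h3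
    rw [div_le_iff₀ hδ] at h4
    linarith
  exact h1.trans h2

/-- For every `δ > 0` there is `V₀ ≥ 1` with `η_V ≤ δ` for all `V ≥ V₀`. [folklore] -/
theorem exists_sawEta_le {δ : ℝ} (hδ : 0 < δ) : ∃ V₀ : ℕ, 1 ≤ V₀ ∧ ∀ V, V₀ ≤ V → sawEta V ≤ δ := by
  obtain ⟨V, hV⟩ : ∃ V : ℕ, 25 / δ ^ 2 ≤ V := exists_nat_ge _
  refine ⟨max V 1, le_max_right _ _, fun V' hV' => sawEta_le_of_le hδ ?_⟩
  exact hV.trans (by exact_mod_cast (le_max_left V 1).trans hV')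

end Literature.NumberTheory.LFunctions.AFE
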